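import Summits.CriticalPhenomena.PercolationContinuityZ3.Theorems.Transplant.FKConnectivityAllQForestAdjacentDenseSeparator
import Summits.CriticalPhenomena.PercolationContinuityZ3.Theorems.Transplant.FKConnectivityAllQForestAdjacentTriangleSeparator
import HarnessLib

/-!
# The path gadget: small facts (gadget geometry, trace arithmetic, toggles)

builds on p205010 (kernel theorem, internal audit signed; external expert review pending).  No definitions, no named facts, no sorries;
standard axioms.

Book-keeping for the involution `Ψ` across a three-point separator `S = {o, p, q}` whose gadget is the PATH `{op, oq}` (memo
bschramm/FROM-fk-1-g20-SEPARATOR-EXCHANGE.md §3; main files `…PathGadgetMoves`, `…PathGadgetTransferA/B`, `…PathGadgetResidual`):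
* `pathGadget_on_S`, `pathGadget_disjoint_of_noPair` — the gadget pairs lie inside `S` and outside any side without pairs inside `S`;
* `pathGadget_no_two_joins` — a class holding a gadget pair cannot join two points of `S` inside side 1 AND two inside side 2
  (`gadget_ncard_add_three_le` with `|S| = 3`);
* `not_reachable_of_joins_all` — a class joining `o, p` and `o, q` inside one side joins nothing inside the other;
* `reachable_pq_of_nondiscrete` — a non-discrete trace that joins neither `o, p` nor `o, q` joins `p, q`;
* `pathGadget_toggle_bookkeeping` — for `K = (M' ∩ E₂) ∪ G` (`G` gadget pairs, all free): the fibre, the side-1 parts and the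
  swapped side-2 parts of `ω ∆ K`, and `(ω ∆ K) ∆ K = ω`.
[cite: Grimmett2006, §1.5 (p. 13); §3.8 (pp. 61–62)]
-/

noncomputable section

namespace Summit.CriticalPhenomena.PercolationContinuityZ3.Theorems

namespace FK

open Set SimpleGraph Literature.Probability.LatticeModels Literature.Probability.Percolation
open scoped Classical

variable {V : Type*} [Fintype V]

section PathGadgetFacts

open scoped symmDiff

variable {E₁ E₂ : Set (Sym2 V)} {o p q : V}

omit [Fintype V] in
/-- The gadget pairs `op, oq` have their endpoints in `S = {o, p, q}`. [folklore] -/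
theorem pathGadget_on_S : ∀ e ∈ ({s(o, p), s(o, q)} : Set (Sym2 V)), ∀ z ∈ e, z ∈ ({o, p, q} : Set V) := by
  intro e he z hz
  rcases he with rfl | he
  · rcases Sym2.mem_iff.1 hz with rfl | rfl
    · exact mem_insert _ _
    · exact mem_insert_of_mem _ (mem_insert _ _)
  · rw [mem_singleton_iff.1 he] at hz
    rcases Sym2.mem_iff.1 hz with rfl | rfl
    · exact mem_insert _ _
    · exact mem_insert_of_mem _ (mem_insert_of_mem _ rfl)

omit [Fintype V] in
/-- A side without pairs inside `S` misses the gadget. [folklore] -/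
theorem pathGadget_disjoint_of_noPair {E : Set (Sym2 V)}
    (hn : ∀ x ∈ ({o, p, q} : Set V), ∀ x' ∈ ({o, p, q} : Set V), s(x, x') ∉ E) :
    Disjoint ({s(o, p), s(o, q)} : Set (Sym2 V)) E := by
  refine Set.disjoint_left.2 fun g hg hgE => ?_
  rcases hg with rfl | hg
  · exact hn o (mem_insert _ _) p (mem_insert_of_mem _ (mem_insert _ _)) hgE
  · rw [mem_singleton_iff.1 hg] at hgE
    exact hn o (mem_insert _ _) q (mem_insert_of_mem _ (mem_insert_of_mem _ rfl)) hgE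

/-- **A class holding a gadget pair does not join two points of `S` inside both sides** (`gadget_ncard_add_three_le`, `|S| = 3`).
[cite: Grimmett2006, §1.5 (p. 13); §3.8 (pp. 61–62)] -/
theorem pathGadget_no_two_joins (hop : o ≠ p) (hoq : o ≠ q) (hpq : p ≠ q) (hd : Disjoint E₁ E₂)
    (hn₁ : ∀ x ∈ ({o, p, q} : Set V), ∀ x' ∈ ({o, p, q} : Set V), s(x, x') ∉ E₁)
    (hn₂ : ∀ x ∈ ({o, p, q} : Set V), ∀ x' ∈ ({o, p, q} : Set V), s(x, x') ∉ E₂)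
    {X : BondConfig V} {x x' r r' : V} (hX : IsForestCfg X) (hx : x ∈ ({o, p, q} : Set V)) (hx' : x' ∈ ({o, p, q} : Set V))
    (hr : r ∈ ({o, p, q} : Set V)) (hr' : r' ∈ ({o, p, q} : Set V)) (hne : x ≠ x') (hne' : r ≠ r')
    (hj₁ : (openGraph (X ∩ E₁)).Reachable x x') (hj₂ : (openGraph (X ∩ E₂)).Reachable r r') :
    ∀ g ∈ ({s(o, p), s(o, q)} : Set (Sym2 V)), g ∉ X := by
  intro g hg hgX
  have h := gadget_ncard_add_three_le (ES := ({s(o, p), s(o, q)} : Set (Sym2 V))) (S := ({o, p, q} : Set V)) pathGadget_on_S hd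
    (pathGadget_disjoint_of_noPair hn₁) (pathGadget_disjoint_of_noPair hn₂) hX hx hx' hr hr' hne hne' hj₁ hj₂
  have h3 : ({o, p, q} : Set V).ncard = 3 := Set.ncard_eq_three.2 ⟨o, p, q, hop, hoq, hpq, rfl⟩
  have h1 : 0 < (X ∩ ({s(o, p), s(o, q)} : Set (Sym2 V))).ncard := (Set.ncard_pos (Set.toFinite _)).2 ⟨g, ⟨hgX, hg⟩⟩
  omega

omit [Fintype V] in
/-- A class joining `o, p` and `o, q` inside one side joins no two points of `S` inside the other side (two disjoint joins).
[cite: Grimmett2006, §1.5 (p. 13)] -/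
theorem not_reachable_of_joins_all {X : BondConfig V} {E E' : Set (Sym2 V)} {x x' : V} (hX : IsForestCfg X)
    (hEE' : Disjoint E E') (hop' : (openGraph (X ∩ E)).Reachable o p) (hoq' : (openGraph (X ∩ E)).Reachable o q)
    (hx : x ∈ ({o, p, q} : Set V)) (hx' : x' ∈ ({o, p, q} : Set V)) (hne : x ≠ x') :
    ¬ (openGraph (X ∩ E')).Reachable x x' := fun hxx' =>
  not_reachable_of_disjoint_join hX inter_subset_left inter_subset_left
    (Set.disjoint_of_subset inter_subset_right inter_subset_right hEE'.symm) hne (reachable_triple_of_two hop' hoq' x hx x' hx') hxx'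

omit [Fintype V] in
/-- A trace on `S = {o, p, q}` that joins two points but neither `o, p` nor `o, q` joins `p, q`. [folklore] -/
theorem reachable_pq_of_nondiscrete {Z : BondConfig V} {x x' : V} (hx : x ∈ ({o, p, q} : Set V)) (hx' : x' ∈ ({o, p, q} : Set V))
    (hne : x ≠ x') (hj : (openGraph Z).Reachable x x') (hnop : ¬ (openGraph Z).Reachable o p)
    (hnoq : ¬ (openGraph Z).Reachable o q) : (openGraph Z).Reachable p q := by
  simp only [mem_insert_iff, mem_singleton_iff] at hx hx'
  rcases hx with rfl | rfl | rfl <;> rcases hx' with rfl | rfl | rfl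
  · exact absurd rfl hne
  · exact absurd hj hnop
  · exact absurd hj hnoq
  · exact absurd hj.symm hnop
  · exact absurd rfl hne
  · exact hj
  · exact absurd hj.symm hnoq
  · exact hj.symm
  · exact absurd rfl hne

omit [Fintype V] in
/-- **Book-keeping of a toggle.**  For `K = (M' ∩ E₂) ∪ G` with `G ⊆ ES` gadget pairs that are free (`G ⊆ M'`), `ES` disjoint from the
sides and the sides disjoint: `ω ∆ K` has the same fibre and the same side-1 parts as `ω`, its side-2 parts are those of the partner,
membership of side-1 pairs is kept and of free side-2 pairs flipped, and toggling twice is the identity. [folklore] -/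
theorem pathGadget_toggle_bookkeeping {ES : Set (Sym2 V)} {M' u₀ ω G : BondConfig V} (hω : ω \ M' = u₀) (hGES : G ⊆ ES)
    (hGM : G ⊆ M') (hES₁ : Disjoint ES E₁) (hd : Disjoint E₁ E₂) :
    (ω ∆ (M' ∩ E₂ ∪ G)) \ M' = u₀ ∧ (ω ∆ (M' ∩ E₂ ∪ G)) ∩ E₁ = ω ∩ E₁ ∧ (ω ∆ (M' ∩ E₂ ∪ G)) ∩ E₂ = (ω ∆ M') ∩ E₂ ∧
      ((ω ∆ (M' ∩ E₂ ∪ G)) ∆ M') ∩ E₁ = (ω ∆ M') ∩ E₁ ∧ ((ω ∆ (M' ∩ E₂ ∪ G)) ∆ M') ∩ E₂ = ω ∩ E₂ ∧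
      (∀ x ∈ E₁, x ∈ ω ∆ (M' ∩ E₂ ∪ G) ↔ x ∈ ω) ∧ (∀ x ∈ M', x ∈ E₂ → (x ∈ ω ∆ (M' ∩ E₂ ∪ G) ↔ x ∉ ω)) ∧
      (ω ∆ (M' ∩ E₂ ∪ G)) ∆ (M' ∩ E₂ ∪ G) = ω := by
  have hKM : M' ∩ E₂ ∪ G ⊆ M' := union_subset inter_subset_left hGM
  have hKE₁ : ∀ x ∈ M' ∩ E₂ ∪ G, x ∉ E₁ := by
    rintro x (hx | hx) hx1
    · exact Set.disjoint_left.1 hd hx1 hx.2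
    · exact Set.disjoint_left.1 hES₁ (hGES hx) hx1
  have hMK : ∀ x ∈ M', x ∈ E₂ → x ∈ M' ∩ E₂ ∪ G := fun x hx hx2 => Or.inl ⟨hx, hx2⟩
  exact ⟨by rw [symmDiff_sdiff_eq_of_subset hKM, hω], symmDiff_inter_eq_of_disjoint hKE₁,
    symmDiff_inter_eq_partner hKM hMK, symmDiff_symmDiff_inter_eq_partner hKM hKE₁,
    symmDiff_symmDiff_inter_eq_self hKM hMK, fun x hx => mem_symmDiff_iff_of_notMem (fun h => hKE₁ x h hx),
    fun x hxM hx2 => mem_symmDiff_iff_of_mem (hMK x hxM hx2), symmDiff_symmDiff_cancel_right _ _⟩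

end PathGadgetFacts

end FK

end Summit.CriticalPhenomena.PercolationContinuityZ3.Theorems

end
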